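import Summits.AtomisticToContinuum.Crystallization.Theorems.ThreeConeCertificateSlackRigidityPricedFloorsMeasurability2
import Summits.AtomisticToContinuum.Crystallization.Theorems.ThreeConeCertificateSlackRigidityPricedFloorsTransport2
import Summits.AtomisticToContinuum.Crystallization.Theorems.PalmUnimodularRigidityCruxesToPalmRigidity
import HarnessLib

/-!
# `SlackRigidity` (stmt-AtomisticToContinuum-11960), line `priced-floors-palm-exactification`, stub S3
# (`stub_layeredMeanSelection`): the layer-transport kernels (package (K), `lms_exists_kernels`)

Lead c19, S3 probabilistic core, part 2.  The transport identity `…Stationarity.lms_lintegral_eq_transport`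
consumes a jointly measurable RECEIVED-weight kernel `Ωr μ y` with total mass one at a.e. sample and the
covariance `Ωr (θ_y μ) (−y) = Ωs μ y`.  This file constructs the pair `(Ωr, Ωs)` for an arbitrary finitely
supported, symmetric, nonnegative layer-weight vector `c` of mass one (registered sub-goal
`lms_exists_kernels`):

* the SENT weight of normal-form data `e`, `w(e, y) = Σ_{|m| ≤ N} c m · 1[y ∈ targets(m)]/#targets(m)`,
  is upper semicontinuous on (normal data) `× ℝ³` (`isClosed_superlevel_sent`: the pairs `(e, y)` with
  `y` a target of layer `m` form a closed set over the clopen fibres of the locally constant label, and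
  `#targets ∈ {1, 3}` is the clopen registry condition), so `lms_measurable_dataSup_joint` extends
  `(count|S, y) ↦ sup_{e fits S} w(e, y)` to a measurable functional of (measure, point)
  (`lms_kernels_sent_functional`); under `LayerRigid S` and `c (−m) = c m` the sent weight is
  presentation invariant (`sent_invariant`), so the supremum is the common value;
* the ideal fcc lattices form a measurable event of measures (`lms_kernels_fcc_event`: projection of a
  closed subset of the compact fitting relation, transferred through `stub_toMeasureEmbedding`), on
  which the transport is patched to the trivial one `1[y = 0]`; `FccLike` is re-rooting invariant;
* `Ωr μ y := Ωs (θ_y (κ μ)) (−y)` with `κ` an s-finite kernel that is the identity on locally finite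
  configurations (`exists_isSFiniteKernel_apply_eq_self`, `measurable_map_sub_kernel`) — covariance is
  then `θ_{−y} θ_y = id`, and BALANCE at a fitted sample is `Σ_{m'} c m' = 1` because each target layer
  of the re-rooted data receives total indicator mass one (`hasSum_targetTerm`, `tsum_sent_reroot`).

No definitions.  All `[folklore]`.
-/

noncomputable section

open MeasureTheory Filter Set Topology
open scoped ENNReal BigOperators

namespace Summit.AtomisticToContinuum.Crystallization.Theorems.SlackRigidityPricedFloorsKernels

open Literature.Probability.Process
open Literature.MathematicalPhysics.StatisticalMechanics
open Summit.AtomisticToContinuum.Crystallization.Theorems.SlackRigidityPricedFloors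
open Summit.AtomisticToContinuum.Crystallization.Theorems.SlackRigidityPricedFloorsTransport
open Summit.AtomisticToContinuum.Crystallization.Theorems.SlackRigidityPricedFloorsMeasurability

/-! ## The sent weight is upper semicontinuous on (normal data) × space -/

/-- The label of layer `m` is continuous (locally constant) on (normal data) `× ℝ³`. [folklore] -/
theorem continuous_label (m : ℤ) :
    Continuous fun x : {e : LData // IsNormalData e} × E3 => haggLabel x.1.1.2.2.1 m :=
  (continuous_haggLabel m).comp ((continuous_fst.comp (continuous_snd.comp continuous_snd)).comp
    (continuous_subtype_val.comp continuous_fst))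

/-- In (normal data) `× ℝ³`, the pairs `(e, y)` with `y` a target of layer `m` of `e` form a closed
set: over each (clopen) fibre of the locally constant label it is a finite union of graphs of the
continuous pattern points. [folklore] -/
theorem isClosed_setOf_mem_layerTargets (m : ℤ) :
    IsClosed {x : {e : LData // IsNormalData e} × E3 | x.2 ∈ layerTargets x.1.1 m} := by
  have hlab := continuous_label m
  have hpt : ∀ i j : ℤ,
      Continuous fun x : {e : LData // IsNormalData e} × E3 => pointOf x.1.1 m i j :=
    fun i j => (continuous_point m i j).comp (continuous_subtype_val.comp continuous_fst)
  set G : ℤ → Set ({e : LData // IsNormalData e} × E3) := fun L =>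
    (fun x : {e : LData // IsNormalData e} × E3 => haggLabel x.1.1.2.2.1 m) ⁻¹' {L} ∩
      ⋃ ij ∈ nearCodes L, {x | x.2 = pointOf x.1.1 m ij.1 ij.2} with hG_def
  have hGc : ∀ L, IsClosed (G L) := fun L =>
    ((isClosed_discrete {L}).preimage hlab).inter
      (isClosed_biUnion_finset fun ij _ => isClosed_eq continuous_snd (hpt ij.1 ij.2))
  have hLF : LocallyFinite G := by
    intro x
    refine ⟨(fun x' : {e : LData // IsNormalData e} × E3 => haggLabel x'.1.1.2.2.1 m) ⁻¹'
      {haggLabel x.1.1.2.2.1 m}, ((isOpen_discrete _).preimage hlab).mem_nhds rfl,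
      (Set.finite_singleton (haggLabel x.1.1.2.2.1 m)).subset ?_⟩
    rintro L ⟨z, ⟨hzL, -⟩, hzt⟩
    exact (hzL.symm.trans hzt : L = _)
  have hEq : {x : {e : LData // IsNormalData e} × E3 | x.2 ∈ layerTargets x.1.1 m} = ⋃ L, G L := by
    ext x
    refine ⟨fun hx => ?_, fun hx => ?_⟩
    · obtain ⟨ij, hij, hx⟩ := Finset.mem_image.1 hx
      exact mem_iUnion.2 ⟨haggLabel x.1.1.2.2.1 m, rfl, mem_iUnion₂.2 ⟨ij, hij, hx.symm⟩⟩
    · obtain ⟨L, hL, hx⟩ := mem_iUnion.1 hx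
      obtain rfl : haggLabel x.1.1.2.2.1 m = L := hL
      obtain ⟨ij, hij, hx⟩ := mem_iUnion₂.1 hx
      exact Finset.mem_image.2 ⟨ij, hij, (hx : x.2 = _).symm⟩
  rw [hEq]
  exact hLF.isClosed_iUnion hGc

/-- One layer's term of the sent weight, `a · 1[y ∈ targets(m)]/#targets(m)` with `a ≥ 0`, is upper
semicontinuous on (normal data) `× ℝ³`: it is `a · 1[closed ∩ aligned] + (a/3) · 1[closed ∩ hole]`
with the registry of layer `m` a clopen condition. [folklore] -/
theorem upperSemicontinuous_term (m : ℤ) {a : ℝ} (ha : 0 ≤ a) :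
    UpperSemicontinuous fun x : {e : LData // IsNormalData e} × E3 =>
      a * (if x.2 ∈ layerTargets x.1.1 m then (1 : ℝ) / (layerTargets x.1.1 m).card else 0) := by
  have hT := isClosed_setOf_mem_layerTargets m
  have hA : IsClopen {x : {e : LData // IsNormalData e} × E3 | haggLabel x.1.1.2.2.1 m % 3 = 0} :=
    (isClopen_discrete {L : ℤ | L % 3 = 0}).preimage (continuous_label m)
  have key : (fun x : {e : LData // IsNormalData e} × E3 =>
      a * (if x.2 ∈ layerTargets x.1.1 m then (1 : ℝ) / (layerTargets x.1.1 m).card else 0)) =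
      fun x => ({x : {e : LData // IsNormalData e} × E3 | x.2 ∈ layerTargets x.1.1 m} ∩
          {x | haggLabel x.1.1.2.2.1 m % 3 = 0}).indicator (fun _ => a) x +
        ({x : {e : LData // IsNormalData e} × E3 | x.2 ∈ layerTargets x.1.1 m} ∩
          {x | haggLabel x.1.1.2.2.1 m % 3 = 0}ᶜ).indicator (fun _ => a / 3) x := by
    funext x
    by_cases hx : x.2 ∈ layerTargets x.1.1 m
    · have hxT : x ∈ {x : {e : LData // IsNormalData e} × E3 | x.2 ∈ layerTargets x.1.1 m} := hx
      rw [if_pos hx, card_layerTargets x.1.2 m]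
      by_cases hl : haggLabel x.1.1.2.2.1 m % 3 = 0
      · have hxA : x ∈ {x : {e : LData // IsNormalData e} × E3 | haggLabel x.1.1.2.2.1 m % 3 = 0} := hl
        rw [if_pos hl, indicator_of_mem (Set.mem_inter hxT hxA),
          indicator_of_notMem (fun h => h.2 hxA)]
        simp
      · have hxA : x ∉ {x : {e : LData // IsNormalData e} × E3 | haggLabel x.1.1.2.2.1 m % 3 = 0} := hl
        rw [if_neg hl, indicator_of_notMem (fun h => hxA h.2),
          indicator_of_mem (Set.mem_inter hxT hxA)]
        push_cast
        ring
    · rw [if_neg hx, mul_zero, indicator_of_notMem (fun h => hx h.1),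
        indicator_of_notMem (fun h => hx h.1), add_zero]
  rw [key]
  exact (IsClosed.upperSemicontinuous_indicator (hT.inter hA.isClosed) ha).add
    (IsClosed.upperSemicontinuous_indicator (hT.inter hA.isOpen.isClosed_compl) (by positivity))

/-- **The sent weight has closed super-level sets** on (normal data) `× ℝ³` (a nonnegative
combination of upper semicontinuous terms). [folklore] -/
theorem isClosed_superlevel_sent (N : ℕ) {c : ℤ → ℝ} (hc0 : ∀ m, 0 ≤ c m) (c₀ : ℝ) :
    IsClosed {x : {e : LData // IsNormalData e} × E3 | c₀ ≤ ∑ m ∈ Finset.Icc (-(N : ℤ)) N,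
      c m * (if x.2 ∈ layerTargets x.1.1 m then (1 : ℝ) / (layerTargets x.1.1 m).card else 0)} :=
  (upperSemicontinuous_iff_isClosed_preimage.1
    (upperSemicontinuous_sum fun m _ => upperSemicontinuous_term m (hc0 m))) c₀

/-- **The sent-weight functional of (measure, point)**: a jointly measurable
`F : Measure ℝ³ × ℝ³ → ℝ` whose value at `(count|S, y)`, for a rooted `δ`-separated `S`, is the
supremum over the normal-form data fitting `S` of the sent weight
`Σ_{|m| ≤ N} c m · 1[y ∈ targets(m)]/#targets(m)`. [folklore] -/
theorem lms_kernels_sent_functional : ∀ (δ : ℝ), 0 < δ → ∀ (N : ℕ) (c : ℤ → ℝ), (∀ m, 0 ≤ c m) → ∃ F : Measure E3 × E3 → ℝ, Measurable F ∧ ∀ (S : Set E3), (0 : E3) ∈ S → (∀ x ∈ S, ∀ y ∈ S, x ≠ y → δ ≤ dist x y) → ∀ y : E3, F ((Measure.count : Measure E3).restrict S, y) = sSup ((fun e : LData => ∑ m ∈ Finset.Icc (-(N : ℤ)) N, c m * (if y ∈ layerTargets e m then (1 : ℝ) / (layerTargets e m).card else 0)) '' {e | Fits S e}) := by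
  intro δ hδ N c hc0
  haveI : Fact (0 < δ) := ⟨hδ⟩
  obtain ⟨-, F, hF, hFeq⟩ := lms_measurable_dataSup_joint δ
    (fun p : LData × E3 => ∑ m ∈ Finset.Icc (-(N : ℤ)) N,
      c m * (if p.2 ∈ layerTargets p.1 m then (1 : ℝ) / (layerTargets p.1 m).card else 0))
    (isClosed_superlevel_sent N hc0)
  exact ⟨F, hF, fun S h0 hsep y => hFeq ⟨⟨S⟩, h0, hsep⟩ y⟩

/-! ## The fcc event -/

/-- The ideal fcc data form a closed subset of `LData`. [folklore] -/
theorem isClosed_setOf_isFccData : IsClosed {e : LData | IsFccData e} := by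
  have ha : Continuous fun e : LData => e.2.1 := continuous_fst.comp continuous_snd
  have hs : ∀ i : ℤ, Continuous fun e : LData => e.2.2.1 i :=
    fun i => (continuous_apply i).comp (continuous_fst.comp (continuous_snd.comp continuous_snd))
  have hz : ∀ m : ℤ, Continuous fun e : LData => e.2.2.2 m :=
    fun m => (continuous_apply m).comp (continuous_snd.comp (continuous_snd.comp continuous_snd))
  simp only [IsFccData, setOf_and, setOf_forall]
  exact (isClosed_iInter fun m => isClosed_eq (hs (m + 1)) (hs m)).inter
    (isClosed_iInter fun m => isClosed_eq ((hz (m + 1)).sub (hz m)) (ha.mul continuous_const))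

/-- **The fcc event**: a Giry-measurable set of measures on `ℝ³` containing the counting measure of
a rooted `δ`-separated `S` iff `FccLike S` (the configurations fitted by ideal fcc data form the
projection of a closed subset of the compact fitting relation, a closed hence Borel set, transferred
through the measurable embedding `S ↦ count|S`). [folklore] -/
theorem lms_kernels_fcc_event : ∀ (δ : ℝ), 0 < δ → ∃ B : Set (Measure E3), MeasurableSet B ∧ ∀ S : Set E3, (0 : E3) ∈ S → (∀ x ∈ S, ∀ y ∈ S, x ≠ y → δ ≤ dist x y) → ((Measure.count : Measure E3).restrict S ∈ B ↔ FccLike S) := by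
  intro δ hδ
  haveI : Fact (0 < δ) := ⟨hδ⟩
  have hemb := SlackRigidityPricedFloorsEmbedding.stub_toMeasureEmbedding δ
  set A : Set (LocalConfig.RootedHardCoreConfig E3 δ) :=
    {T | FccLike ((T.1 : LocalConfig E3) : Set E3)} with hA_def
  have hAeq : A = Prod.fst '' ({x : LocalConfig.RootedHardCoreConfig E3 δ × LData |
      Fits ((x.1.1 : LocalConfig E3) : Set E3) x.2} ∩ {x | IsFccData x.2}) := by
    ext T
    constructor
    · rintro ⟨e, he, hfcc⟩
      exact ⟨(T, e), ⟨he, hfcc⟩, rfl⟩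
    · rintro ⟨⟨T', e⟩, ⟨he, hfcc⟩, rfl⟩
      exact ⟨e, he, hfcc⟩
  have hAc : IsClosed A := by
    rw [hAeq]
    exact isClosed_image_fst_of_subset_fits
      ((lms_isClosed_fits δ).inter (isClosed_setOf_isFccData.preimage continuous_snd))
      fun x hx => hx.1
  refine ⟨(fun T : LocalConfig.RootedHardCoreConfig E3 δ => (T.1 : LocalConfig E3).toMeasure) '' A,
    hemb.measurableSet_image.2 hAc.measurableSet, fun S h0 hsep => ⟨?_, fun hS => ?_⟩⟩
  · rintro ⟨T, hT, hTS⟩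
    have hT' : T = ⟨⟨S⟩, h0, hsep⟩ := hemb.injective hTS
    subst hT'
    exact hT
  · exact ⟨⟨⟨S⟩, h0, hsep⟩, hS, rfl⟩

/-! ## Presentation invariance of the sent weight -/

/-- Under `LayerRigid S` and `c (-m) = c m` the sent weight does not depend on the data fitting `S`
(targets depend only on the layers, `layerTargets_eq_of_layerOf_eq`; flip `m ↦ -m`). [folklore] -/
theorem sent_invariant {S : Set E3} (hR : LayerRigid S) {e e' : LData} (he : Fits S e)
    (he' : Fits S e') (N : ℕ) {c : ℤ → ℝ} (hcsym : ∀ m, c (-m) = c m) (y : E3) :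
    ∑ m ∈ Finset.Icc (-(N : ℤ)) N,
        c m * (if y ∈ layerTargets e' m then (1 : ℝ) / (layerTargets e' m).card else 0) =
      ∑ m ∈ Finset.Icc (-(N : ℤ)) N,
        c m * (if y ∈ layerTargets e m then (1 : ℝ) / (layerTargets e m).card else 0) := by
  rcases hR e e' he he' with h | h
  · refine Finset.sum_congr rfl fun m _ => ?_
    rw [layerTargets_eq_of_layerOf_eq he.1 he'.1 (h m)]
  · refine Finset.sum_equiv (Equiv.neg ℤ) (fun m => ?_) (fun m _ => ?_)
    · simp only [Finset.mem_Icc, Equiv.neg_apply]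
      omega
    · rw [layerTargets_eq_of_layerOf_eq he.1 he'.1 (h m), Equiv.neg_apply, hcsym]

/-! ## Fcc-likeness is invariant under re-rooting -/

/-- Re-rooted fcc data are fcc data. [folklore] -/
theorem isFccData_rerootData {e : LData} (h : IsFccData e) (m : ℤ) : IsFccData (rerootData e m) := by
  obtain ⟨hs, hz⟩ := h
  refine ⟨fun k => ?_, fun k => ?_⟩
  · simp only [rerootData]
    rw [show k + 1 + m = k + m + 1 by ring]
    exact hs (k + m)
  · simp only [rerootData]
    rw [show k + 1 + m = k + m + 1 by ring]
    have := hz (k + m)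
    linarith

/-- `FccLike` passes to the set re-rooted at one of its points. [folklore] -/
theorem fccLike_image_sub {S : Set E3} (h : FccLike S) {y : E3} (hy : y ∈ S) :
    FccLike ((fun x => x - y) '' S) := by
  obtain ⟨e, he, hfcc⟩ := h
  have hy' : y ∈ dataSet e := by rw [he.2]; exact hy
  obtain ⟨m, i, j, rfl⟩ := hy'
  exact ⟨rerootData e m, lms_rerootData_fits S e m i j he, isFccData_rerootData hfcc m⟩

/-- Conversely, a fitted set whose re-rooting at one of its points is `FccLike` is `FccLike`
(re-root back at the old root). [folklore] -/
theorem fccLike_of_image_sub {S : Set E3} {e : LData} (he : Fits S e) {y : E3}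
    (h : FccLike ((fun x => x - y) '' S)) : FccLike S := by
  have h0 : (0 : E3) ∈ S := by
    rw [← he.2]
    exact ⟨0, 0, 0, (pointOf_zero e he.1.2.2).symm⟩
  have := fccLike_image_sub h (y := -y) ⟨0, h0, zero_sub y⟩
  rw [image_image] at this
  simpa using this

/-! ## Balance of the sent weights over the re-rooted data -/

/-- **Total sent weight seen from all points is one**: summing, over all pattern points
`y = (m, i, j)` of normal data `e`, the sent weight of the data re-rooted at `y` evaluated at the
old root `-y` gives `Σ_{m'} c m' = 1` (each target layer receives total indicator mass one,
`hasSum_targetTerm`). In `ℝ≥0∞`. [folklore] -/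
theorem tsum_sent_reroot {e : LData} (he : IsNormalData e) (N : ℕ) {c : ℤ → ℝ}
    (hc0 : ∀ m, 0 ≤ c m) (hc1 : ∑ m ∈ Finset.Icc (-(N : ℤ)) N, c m = 1) :
    ∑' t : ℤ × ℤ × ℤ, ENNReal.ofReal (∑ m ∈ Finset.Icc (-(N : ℤ)) N, c m *
      (if -(pointOf e t.1 t.2.1 t.2.2) ∈ layerTargets (rerootData e t.1) m
        then (1 : ℝ) / (layerTargets (rerootData e t.1) m).card else 0)) = 1 := by
  set T : ℤ → ℤ × ℤ × ℤ → ℝ := fun m t =>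
    if -(pointOf e t.1 t.2.1 t.2.2) ∈ layerTargets (rerootData e t.1) m
      then (1 : ℝ) / (layerTargets (rerootData e t.1) m).card else 0 with hT_def
  have hT0 : ∀ m t, 0 ≤ T m t := fun m t => by
    simp only [hT_def]
    split_ifs <;> positivity
  have hTs : ∀ m, HasSum (T m) 1 := fun m => hasSum_targetTerm he m
  calc ∑' t : ℤ × ℤ × ℤ, ENNReal.ofReal (∑ m ∈ Finset.Icc (-(N : ℤ)) N, c m * T m t)
      = ∑' t : ℤ × ℤ × ℤ, ∑ m ∈ Finset.Icc (-(N : ℤ)) N,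
          ENNReal.ofReal (c m) * ENNReal.ofReal (T m t) := by
        refine tsum_congr fun t => ?_
        rw [ENNReal.ofReal_sum_of_nonneg (fun m _ => mul_nonneg (hc0 m) (hT0 m t))]
        exact Finset.sum_congr rfl fun m _ => ENNReal.ofReal_mul (hc0 m)
    _ = ∑ m ∈ Finset.Icc (-(N : ℤ)) N, ∑' t : ℤ × ℤ × ℤ,
          ENNReal.ofReal (c m) * ENNReal.ofReal (T m t) :=
        Summable.tsum_finsetSum (fun _ _ => ENNReal.summable)
    _ = ∑ m ∈ Finset.Icc (-(N : ℤ)) N, ENNReal.ofReal (c m) := by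
        refine Finset.sum_congr rfl fun m _ => ?_
        rw [ENNReal.tsum_mul_left, ← ENNReal.ofReal_tsum_of_nonneg (hT0 m) (hTs m).summable,
          (hTs m).tsum_eq, ENNReal.ofReal_one, mul_one]
    _ = 1 := by rw [← ENNReal.ofReal_sum_of_nonneg (fun m _ => hc0 m), hc1, ENNReal.ofReal_one]

/-! ## The kernels -/

/-- **(K) The layer-transport kernels** (registered sub-goal `lms_exists_kernels` of
`stub_layeredMeanSelection`).  For a finitely supported, symmetric, nonnegative layer-weight vector
`c` of total mass one there are jointly measurable RECEIVED / SENT weight kernels `Ωr`, `Ωs` on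
(measure, point) such that for every rooted `δ`-separated sample `S` fitted by normal-form data `e`:
the received weights have total mass one (BALANCE), the received weight seen from `y` is the sent
weight (COVARIANCE, `Ωr (θ_y μ) (−y) = Ωs μ y`), the sent weight is the explicit
`Σ_m c m · 1[y ∈ targets(m)]/#targets(m)` when `S` is not an ideal fcc lattice (granted rigidity of
the layer system off the fcc lattices), and the trivial transport `1[y = 0]` when it is.
Construction: `Ωs` is the measurable sup-over-fitting-data extension of the (upper semicontinuous)
sent weight (`lms_measurable_dataSup_joint`), patched on the measurable fcc event;
`Ωr μ y := Ωs (θ_y (κ μ)) (−y)` with `κ` an s-finite kernel that is the identity on locally finite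
configurations (`exists_isSFiniteKernel_apply_eq_self`, `measurable_map_sub_kernel`). [folklore] -/
theorem lms_exists_kernels : ∀ (δ : ℝ), 0 < δ → ∀ (N : ℕ) (c : ℤ → ℝ), (∀ m, 0 ≤ c m) → (∀ m, c (-m) = c m) → (∀ m : ℤ, (N : ℤ) < |m| → c m = 0) → (∑ m ∈ Finset.Icc (-(N : ℤ)) N, c m = 1) → (∀ S : Set E3, ¬ FccLike S → LayerRigid S) → ∃ Ωr Ωs : Measure E3 → E3 → ℝ≥0∞, Measurable (Function.uncurry Ωr) ∧ Measurable (Function.uncurry Ωs) ∧ ∀ (S : Set E3) (e : LData), (0 : E3) ∈ S → (∀ x ∈ S, ∀ y ∈ S, x ≠ y → δ ≤ dist x y) → Fits S e → (∫⁻ y, Ωr ((Measure.count : Measure E3).restrict S) y ∂((Measure.count : Measure E3).restrict S) = 1) ∧ (∀ y ∈ S, Ωr (((Measure.count : Measure E3).restrict S).map (fun z => z - y)) (-y) = Ωs ((Measure.count : Measure E3).restrict S) y) ∧ (¬ FccLike S → ∀ y : E3, Ωs ((Measure.count : Measure E3).restrict S) y = ENNReal.ofReal (∑ m ∈ Finset.Icc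 (-(N : ℤ)) N, c m * (if y ∈ layerTargets e m then (1 : ℝ) / (layerTargets e m).card else 0))) ∧ (FccLike S → ∀ y : E3, Ωs ((Measure.count : Measure E3).restrict S) y = if y = 0 then 1 else 0) := by
  intro δ hδ N c hc0 hcsym _ hc1 hU
  classical
  obtain ⟨F, hFm, hFeq⟩ := lms_kernels_sent_functional δ hδ N c hc0
  obtain ⟨B, hBm, hB⟩ := lms_kernels_fcc_event δ hδ
  obtain ⟨κ, hκ, hκid⟩ := PalmUnimodularRigidity.exists_isSFiniteKernel_apply_eq_self
    (fun n : ℕ => (fun z : E3 => ⌊‖z‖⌋₊) ⁻¹' {n})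
    PalmUnimodularRigidity.measurableSet_floorNorm_preimage
    (fun i j hij => Set.disjoint_iff.2 fun z hz => hij (hz.1.symm.trans hz.2))
    (fun z => ⟨⌊‖z‖⌋₊, rfl⟩)
  haveI := hκ
  obtain ⟨Ωs, hΩs⟩ : ∃ Ωs : Measure E3 → E3 → ℝ≥0∞, Ωs = fun μ y =>
      if μ ∈ B then (if y = 0 then 1 else 0) else ENNReal.ofReal (F (μ, y)) := ⟨_, rfl⟩
  obtain ⟨Ωr, hΩr⟩ : ∃ Ωr : Measure E3 → E3 → ℝ≥0∞, Ωr = fun μ y =>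
      Ωs ((κ μ).map (fun z => z - y)) (-y) := ⟨_, rfl⟩
  have hΩsm : Measurable (Function.uncurry Ωs) := by
    rw [hΩs]
    exact Measurable.ite (measurable_fst hBm)
      (Measurable.ite (measurable_snd (measurableSet_singleton 0)) measurable_const
        measurable_const) (ENNReal.measurable_ofReal.comp hFm)
  have hΩrm : Measurable (Function.uncurry Ωr) := by
    rw [hΩr]
    exact hΩsm.comp ((PalmUnimodularRigidity.measurable_map_sub_kernel κ).prodMk
      measurable_snd.neg)
  refine ⟨Ωr, Ωs, hΩrm, hΩsm, fun S e h0 hsep he => ?_⟩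
  -- bookkeeping on re-rooted samples
  have hlf : ∀ S' : Set E3, (∀ x ∈ S', ∀ y ∈ S', x ≠ y → δ ≤ dist x y) →
      κ ((Measure.count : Measure E3).restrict S') = (Measure.count : Measure E3).restrict S' :=
    fun S' hS' => hκid _ fun n =>
      PalmUnimodularRigidity.count_restrict_floorNorm_preimage_lt_top hδ hS' n
  have hsepy : ∀ (y : E3), ∀ x ∈ (fun x => x - y) '' S, ∀ x' ∈ (fun x => x - y) '' S,
      x ≠ x' → δ ≤ dist x x' := by
    rintro y _ ⟨x, hx, rfl⟩ _ ⟨x', hx', rfl⟩ hne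
    rw [dist_sub_right]
    exact hsep x hx x' hx' fun h => hne (by rw [h])
  have h0y : ∀ y ∈ S, (0 : E3) ∈ (fun x => x - y) '' S := fun y hy => ⟨y, hy, sub_self y⟩
  have hΩrS : ∀ y : E3, Ωr ((Measure.count : Measure E3).restrict S) y =
      Ωs ((Measure.count : Measure E3).restrict ((fun x => x - y) '' S)) (-y) := by
    intro y
    rw [hΩr]
    dsimp only
    rw [hlf S hsep, map_sub_count_restrict]
  have hΩs_fcc : ∀ S' : Set E3, (0 : E3) ∈ S' → (∀ x ∈ S', ∀ y ∈ S', x ≠ y → δ ≤ dist x y) →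
      FccLike S' → ∀ y : E3, Ωs ((Measure.count : Measure E3).restrict S') y =
        if y = 0 then 1 else 0 := by
    intro S' h0' hsep' hf y
    rw [hΩs]
    dsimp only
    rw [if_pos ((hB S' h0' hsep').2 hf)]
  have hΩs_nf : ∀ (S' : Set E3) (e' : LData), (0 : E3) ∈ S' →
      (∀ x ∈ S', ∀ y ∈ S', x ≠ y → δ ≤ dist x y) → Fits S' e' → ¬ FccLike S' → ∀ y : E3,
      Ωs ((Measure.count : Measure E3).restrict S') y = ENNReal.ofReal
        (∑ m ∈ Finset.Icc (-(N : ℤ)) N,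
          c m * (if y ∈ layerTargets e' m then (1 : ℝ) / (layerTargets e' m).card else 0)) := by
    intro S' e' h0' hsep' he' hnf y
    rw [hΩs]
    dsimp only
    rw [if_neg (mt (hB S' h0' hsep').1 hnf), hFeq S' h0' hsep' y]
    congr 1
    exact dataSup_eq_of_forall_eq he' fun e'' he'' => sent_invariant (hU S' hnf) he' he'' N hcsym y
  refine ⟨?_, fun y _ => ?_, hΩs_nf S e h0 hsep he, hΩs_fcc S h0 hsep⟩
  · -- balance: `S` is parametrised by `ℤ³`
    have hmem : ∀ t : ℤ × ℤ × ℤ, pointOf e t.1 t.2.1 t.2.2 ∈ S := fun t => by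
      rw [← he.2]; exact ⟨t.1, t.2.1, t.2.2, rfl⟩
    have hbij : Function.Bijective fun t : ℤ × ℤ × ℤ => (⟨pointOf e t.1 t.2.1 t.2.2, hmem t⟩ : S) := by
      constructor
      · intro t t' h
        obtain ⟨h1, h2, h3⟩ := pointOf_injective he.1 (congrArg Subtype.val h)
        exact Prod.ext h1 (Prod.ext h2 h3)
      · rintro ⟨y, hy⟩
        have hy' : y ∈ dataSet e := by rw [he.2]; exact hy
        obtain ⟨m, i, j, rfl⟩ := hy'
        exact ⟨(m, i, j), rfl⟩
    have hSc : S.Countable :=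
      Set.countable_coe_iff.1 (Countable.of_equiv _ (Equiv.ofBijective _ hbij))
    rw [lintegral_countable _ hSc]
    simp only [Measure.count_singleton, mul_one]
    by_cases hf : FccLike S
    · have key : ∀ y : S, Ωr ((Measure.count : Measure E3).restrict S) y =
          if y = ⟨0, h0⟩ then 1 else 0 := by
        intro y
        rw [hΩrS, hΩs_fcc _ (h0y y y.2) (hsepy y) (fccLike_image_sub hf y.2)]
        simp only [neg_eq_zero, Subtype.ext_iff]
      rw [tsum_congr key]
      exact tsum_ite_eq (⟨0, h0⟩ : S) (fun _ => (1 : ℝ≥0∞))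
    · rw [← (Equiv.ofBijective _ hbij).tsum_eq]
      have key : ∀ t : ℤ × ℤ × ℤ,
          Ωr ((Measure.count : Measure E3).restrict S) (Equiv.ofBijective _ hbij t) =
          ENNReal.ofReal (∑ m ∈ Finset.Icc (-(N : ℤ)) N, c m *
            (if -(pointOf e t.1 t.2.1 t.2.2) ∈ layerTargets (rerootData e t.1) m
              then (1 : ℝ) / (layerTargets (rerootData e t.1) m).card else 0)) := by
        intro t
        rw [Equiv.ofBijective_apply, hΩrS,
          hΩs_nf _ (rerootData e t.1) (h0y _ (hmem t)) (hsepy _)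
            (lms_rerootData_fits S e t.1 t.2.1 t.2.2 he)
            (fun hf' => hf (fccLike_of_image_sub he hf'))]
      rw [tsum_congr key]
      exact tsum_sent_reroot he.1 N hc0 hc1
  · -- covariance
    rw [hΩr]
    dsimp only
    rw [map_sub_count_restrict, hlf _ (hsepy y), map_sub_count_restrict, neg_neg, image_image]
    congr 2
    simp

end Summit.AtomisticToContinuum.Crystallization.Theorems.SlackRigidityPricedFloorsKernels

end
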